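import Summits.QuantumFields.BalabanUV.Beta.GAN24.FibreSymbols

/-!
# `BalabanUV.Beta.GAN24.FibreGaffney` — binder row G-an2-4 / (CONV-C), road P1-fibre, node N08 of `SKELETON-P1.md` §8 («Poincaré–Gaffney on the fibre»,
# ingredient A4(i) / the real-momentum coercivity consumed by A5): the HODGE / LAGRANGE–GAFFNEY identities for ONE fine momentum of the typed `U = 1`
# KKT fibre, in the vocabulary of `GAN24/FibreSymbols` (`dhat`, `dflat`, `lapSym`)

NOT IN PRINT; OUR PROOF ATTEMPT.  HONEST FRAMING (cell contract, verbatim): «discharging `BetaPertH` makes Bałaban's UV stability UNCONDITIONAL — a real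
constructive-QFT result; it is NOT the continuum limit and NOT the Clay problem.»  HONEST DEPENDENCY (verbatim): «continuum YM on T⁴ ⇐ BetaPertH ∧ nine spine
estimates (0/9 proved); BetaPertH ⇐ (D1) ∧ (D4) ∧ CAP+tail; G-an2-4 gates asym, D1 and NE2/3/4.»  [folklore] finite-dimensional algebra over `ℂ` (no estimate beyond
`0 ≤ Σ‖·‖²`, no cited fact, no definition, no wall binder).  Discharges NOTHING of the K-slot of (CONV-C); NOT summit progress.

## What is proved (generic dimension `D`; `k : Fin D → ℂ` a fine momentum, `v : Fin D → ℂ` a 1-form polarisation)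
Write `∂̂_κ = dhat k κ`, `∂̂♭_κ = dflat k κ`, `L = lapSym k = Σ_κ ∂̂_κ ∂̂♭_κ`, the CURL SYMBOL `c_{κl} = ∂̂_κ v_l − ∂̂_l v_κ` (`FibreSymbols.curv_plane`) and the
DIVERGENCE SYMBOL `δ = Σ_κ ∂̂♭_κ v_κ` (`FibreSymbols.codiff₁_plane`).
* `hodge_fibre` (ALL complex `k`):  `L · v_κ = ∂̂_κ · δ − Σ_l ∂̂♭_l · c_{κl}` — the fibre form of `Δ = dδ + δd` on 1-forms; hence a curl-free polarisation is
  longitudinal (`longitudinal_of_curl_zero`: `L · v_κ = ∂̂_κ · δ`).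
* REAL momenta (`∀ κ, conj (k κ) = k κ`): `dflat_eq_conj_dhat` (`∂̂♭ = conj ∂̂`), `lapSym_eq_sum_normSq` (`L = ↑Σ_κ ‖∂̂_κ‖²`, so `L` is real and `≥ 0`, and `> 0` as soon as
  one `∂̂_κ ≠ 0`, `lapSym_re_pos`);
* `lagrange_polarised` (any coefficient vectors): the polarised LAGRANGE identity `2(Σ a x)(Σ b y) = ΣΣ (a_κ b_l − a_l b_κ)(x_κ y_l − x_l y_κ) + 2(Σ x b)(Σ a y)`;
* `gaffney_normSq` (real `k`):  `Re L · Σ_κ ‖v_κ‖² = ½ Σ_{κ,l} ‖c_{κl}‖² + ‖δ‖²`  — the LAGRANGE–GAFFNEY norm identity on the fibre;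
* `curlBlock_form_eq` (real `k`):  `Σ_μ conj(v_μ) · 2(L v_μ − ∂̂_μ δ) = ↑Σ_{κ,l} ‖c_{κl}‖²` — the quadratic form of the A–A block `2(L·1 − ∂̂∂̂♭ᵀ)` of `T(k)`
  (`FibreSymbols.curvAdj_curv_plane`) IS the curl energy, in particular real and `≥ 0` (`curlBlock_form_nonneg`), and `… + 2‖δ‖² = 2·Re L·Σ‖v‖²` (`gaffney_form`);
* `normSq_le_of_le_lapSym` (real `k`): the fibre POINCARÉ–GAFFNEY inequality `0 < λ ≤ Re L(k) ⇒ Σ_κ ‖v_κ‖² ≤ (½ Σ‖c‖² + ‖δ‖²)/λ`, and its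
  block-form twin `mul_normSq_le_curlBlock_form` (`λ·Σ‖v‖² ≤ ½·Re⟨v, A–A block v⟩ + ‖δ‖²`); `lapSym_ne_zero` (real `k`, one `∂̂_κ ≠ 0`);
* `curlBlock_form_of_coclosed` (ALL `k`): for a co-closed polarisation (`δ = 0`, the transverse / Landau slice) the A–A form is `2 L Σ_μ conj(v_μ) v_μ`.
The lower bound `λ` (e.g. `(4/π²)|k|²`-type bounds at real momenta) is NOT proved here — it is the business of row P1-L07 (`GAN24/SymbolTaylor`); the alias
weights of row P1-L06 are not touched either.  Nothing here asserts a wall binder or a rate.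
-/

open Complex Finset
open scoped BigOperators ComplexConjugate

namespace Summit.QuantumFields.BalabanUV.Beta.GAN24.FibreGaffney

open FibreSymbols (dhat dflat lapSym)

variable {D : ℕ}

/-! ### 1. The fibre Hodge identity (all complex momenta) -/

/-- [folklore] **HODGE IDENTITY ON THE FIBRE** (`Δ = dδ + δd` for 1-forms, per fine momentum, any complex `k`):
`L(k)·v_κ = ∂̂_κ (Σ_l ∂̂♭_l v_l) − Σ_l ∂̂♭_l (∂̂_κ v_l − ∂̂_l v_κ)`. -/
theorem hodge_fibre (k v : Fin D → ℂ) (κ : Fin D) :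
    lapSym k * v κ = dhat k κ * (∑ l, dflat k l * v l) - ∑ l, dflat k l * (dhat k κ * v l - dhat k l * v κ) := by
  unfold lapSym
  rw [Finset.sum_mul, Finset.mul_sum, ← Finset.sum_sub_distrib]
  exact Finset.sum_congr rfl fun l _ => by ring

/-- [folklore] A CURL-FREE polarisation is LONGITUDINAL: if `∂̂_κ v_l = ∂̂_l v_κ` for all `κ, l` then `L(k)·v_κ = ∂̂_κ · (∂̂♭·v)` (any complex `k`). -/
theorem longitudinal_of_curl_zero (k v : Fin D → ℂ) (hcurl : ∀ κ l, dhat k κ * v l - dhat k l * v κ = 0) (κ : Fin D) :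
    lapSym k * v κ = dhat k κ * ∑ l, dflat k l * v l := by
  rw [hodge_fibre k v κ]
  simp [hcurl]

/-- [folklore] CO-CLOSED (transverse, Landau-slice) polarisations: if `∂̂♭·v = 0` then the A–A block form `Σ_μ conj(v_μ)·2(L v_μ − ∂̂_μ(∂̂♭·v))` equals
`2 L Σ_μ conj(v_μ) v_μ` (any complex `k`). -/
theorem curlBlock_form_of_coclosed (k v : Fin D → ℂ) (hδ : ∑ l, dflat k l * v l = 0) :
    ∑ μ, conj (v μ) * (2 * (lapSym k * v μ - dhat k μ * ∑ l, dflat k l * v l)) = 2 * lapSym k * ∑ μ, conj (v μ) * v μ := by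
  rw [hδ, Finset.mul_sum]
  exact Finset.sum_congr rfl fun μ _ => by ring

/-! ### 2. Real momenta: the conjugation dictionary -/

/-- [folklore] At a REAL momentum (`conj k_κ = k_κ`) the reflected symbol is the complex conjugate of the forward one: `∂̂♭_κ = conj ∂̂_κ`. -/
theorem dflat_eq_conj_dhat {k : Fin D → ℂ} (hk : ∀ κ, conj (k κ) = k κ) (κ : Fin D) : dflat k κ = conj (dhat k κ) := by
  unfold dflat dhat
  rw [map_sub, map_one, ← Complex.exp_conj, map_mul, Complex.conj_I, hk, neg_mul]

/-- [folklore] … equivalently `conj ∂̂♭_κ = ∂̂_κ`. -/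
theorem conj_dflat {k : Fin D → ℂ} (hk : ∀ κ, conj (k κ) = k κ) (κ : Fin D) : conj (dflat k κ) = dhat k κ := by
  rw [dflat_eq_conj_dhat hk, Complex.conj_conj]

/-- [folklore] At a real momentum `∂̂_κ ∂̂♭_κ = ‖∂̂_κ‖²`. -/
theorem dhat_mul_dflat {k : Fin D → ℂ} (hk : ∀ κ, conj (k κ) = k κ) (κ : Fin D) :
    dhat k κ * dflat k κ = ((Complex.normSq (dhat k κ) : ℝ) : ℂ) := by
  rw [dflat_eq_conj_dhat hk, Complex.mul_conj]

/-- [folklore] At a real momentum the Laplacian symbol is the real number `Σ_κ ‖∂̂_κ‖²` (`= Σ_κ 4 sin²(k_κ/2)`). -/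
theorem lapSym_eq_sum_normSq {k : Fin D → ℂ} (hk : ∀ κ, conj (k κ) = k κ) :
    lapSym k = ((∑ κ, Complex.normSq (dhat k κ) : ℝ) : ℂ) := by
  unfold lapSym
  rw [Complex.ofReal_sum]
  exact Finset.sum_congr rfl fun κ _ => dhat_mul_dflat hk κ

/-- [folklore] Real part of the Laplacian symbol at a real momentum. -/
theorem lapSym_re {k : Fin D → ℂ} (hk : ∀ κ, conj (k κ) = k κ) : (lapSym k).re = ∑ κ, Complex.normSq (dhat k κ) := by
  rw [lapSym_eq_sum_normSq hk, Complex.ofReal_re]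

/-- [folklore] The Laplacian symbol at a real momentum has no imaginary part. -/
theorem lapSym_im {k : Fin D → ℂ} (hk : ∀ κ, conj (k κ) = k κ) : (lapSym k).im = 0 := by
  rw [lapSym_eq_sum_normSq hk, Complex.ofReal_im]

/-- [folklore] `0 ≤ L(k)` at a real momentum. -/
theorem lapSym_re_nonneg {k : Fin D → ℂ} (hk : ∀ κ, conj (k κ) = k κ) : 0 ≤ (lapSym k).re := by
  rw [lapSym_re hk]
  exact Finset.sum_nonneg fun κ _ => Complex.normSq_nonneg _

/-- [folklore] `0 < L(k)` at a real momentum off the zero mode: as soon as one `∂̂_κ(k) ≠ 0` (i.e. `k_κ ∉ 2πℤ`). -/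
theorem lapSym_re_pos {k : Fin D → ℂ} (hk : ∀ κ, conj (k κ) = k κ) {κ : Fin D} (hκ : dhat k κ ≠ 0) : 0 < (lapSym k).re := by
  rw [lapSym_re hk]
  exact lt_of_lt_of_le (Complex.normSq_pos.mpr hκ)
    (Finset.single_le_sum (fun l _ => Complex.normSq_nonneg (dhat k l)) (Finset.mem_univ κ))

/-- [folklore] Hence `L(k) ≠ 0` there. -/
theorem lapSym_ne_zero {k : Fin D → ℂ} (hk : ∀ κ, conj (k κ) = k κ) {κ : Fin D} (hκ : dhat k κ ≠ 0) : lapSym k ≠ 0 := by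
  intro h
  have := lapSym_re_pos hk hκ
  rw [h, Complex.zero_re] at this
  exact lt_irrefl _ this

/-! ### 3. The Lagrange–Gaffney identity -/

/-- [folklore] **POLARISED LAGRANGE IDENTITY** (commutative algebra, four arbitrary coefficient vectors):
`2·(Σ_κ a_κ x_κ)(Σ_l b_l y_l) = Σ_κ Σ_l (a_κ b_l − a_l b_κ)(x_κ y_l − x_l y_κ) + 2·(Σ_κ x_κ b_κ)(Σ_l a_l y_l)` (stated with the factor `2` cleared). -/
theorem lagrange_polarised (a b x y : Fin D → ℂ) :
    2 * ((∑ κ, a κ * x κ) * (∑ l, b l * y l))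
      = (∑ κ, ∑ l, (a κ * b l - a l * b κ) * (x κ * y l - x l * y κ)) + 2 * ((∑ κ, x κ * b κ) * (∑ l, a l * y l)) := by
  have h : ∀ κ l, (a κ * b l - a l * b κ) * (x κ * y l - x l * y κ)
      = ((a κ * x κ) * (b l * y l) + (a l * x l) * (b κ * y κ)) - ((a κ * y κ) * (x l * b l) + (a l * y l) * (x κ * b κ)) := by
    intro κ l; ring
  have T1 : ∑ κ, ∑ l, (a κ * x κ) * (b l * y l) = (∑ κ, a κ * x κ) * (∑ l, b l * y l) := by rw [Finset.sum_mul_sum]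
  have T2 : ∑ κ, ∑ l, (a l * x l) * (b κ * y κ) = (∑ κ, a κ * x κ) * (∑ l, b l * y l) := by
    rw [Finset.sum_comm, Finset.sum_mul_sum]
  have T3 : ∑ κ, ∑ l, (a κ * y κ) * (x l * b l) = (∑ κ, a κ * y κ) * (∑ l, x l * b l) := by rw [Finset.sum_mul_sum]
  have T4 : ∑ κ, ∑ l, (a l * y l) * (x κ * b κ) = (∑ κ, a κ * y κ) * (∑ l, x l * b l) := by
    rw [Finset.sum_comm, Finset.sum_mul_sum]
  simp_rw [h]
  simp only [Finset.sum_sub_distrib, Finset.sum_add_distrib]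
  rw [T1, T2, T3, T4]
  ring

/-- [folklore] **LAGRANGE–GAFFNEY NORM IDENTITY ON THE FIBRE** (real momentum): `Re L(k) · Σ_κ ‖v_κ‖² = ½ Σ_{κ,l} ‖∂̂_κ v_l − ∂̂_l v_κ‖² + ‖Σ_κ ∂̂♭_κ v_κ‖²`
— squared norm times the Laplacian symbol = half the curl energy plus the divergence energy (`Δ = δd + dδ` in norm form). -/
theorem gaffney_normSq {k : Fin D → ℂ} (hk : ∀ κ, conj (k κ) = k κ) (v : Fin D → ℂ) :
    (lapSym k).re * ∑ κ, Complex.normSq (v κ)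
      = (1 / 2) * (∑ κ, ∑ l, Complex.normSq (dhat k κ * v l - dhat k l * v κ)) + Complex.normSq (∑ κ, dflat k κ * v κ) := by
  -- the complex identity, specialised to `x = conj ∂̂ = ∂̂♭`, `y = conj v`
  have hC := lagrange_polarised (dhat k) v (fun κ => conj (dhat k κ)) (fun κ => conj (v κ))
  have e1 : ∑ κ, dhat k κ * conj (dhat k κ) = ((∑ κ, Complex.normSq (dhat k κ) : ℝ) : ℂ) := by
    rw [Complex.ofReal_sum]; exact Finset.sum_congr rfl fun κ _ => Complex.mul_conj _
  have e2 : ∑ l, v l * conj (v l) = ((∑ l, Complex.normSq (v l) : ℝ) : ℂ) := by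
    rw [Complex.ofReal_sum]; exact Finset.sum_congr rfl fun l _ => Complex.mul_conj _
  have e3 : ∑ κ, ∑ l, (dhat k κ * v l - dhat k l * v κ) * (conj (dhat k κ) * conj (v l) - conj (dhat k l) * conj (v κ))
      = ((∑ κ, ∑ l, Complex.normSq (dhat k κ * v l - dhat k l * v κ) : ℝ) : ℂ) := by
    rw [Complex.ofReal_sum]
    refine Finset.sum_congr rfl fun κ _ => ?_
    rw [Complex.ofReal_sum]
    refine Finset.sum_congr rfl fun l _ => ?_
    rw [← Complex.mul_conj, map_sub, map_mul, map_mul]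
  have e4 : ∑ κ, conj (dhat k κ) * v κ = ∑ κ, dflat k κ * v κ :=
    Finset.sum_congr rfl fun κ _ => by rw [dflat_eq_conj_dhat hk]
  have e5 : ∑ l, dhat k l * conj (v l) = conj (∑ κ, dflat k κ * v κ) := by
    rw [map_sum]; exact Finset.sum_congr rfl fun l _ => by rw [map_mul, conj_dflat hk]
  rw [e1, e2, e3, e4, e5, Complex.mul_conj] at hC
  have hR : 2 * ((∑ κ, Complex.normSq (dhat k κ)) * ∑ l, Complex.normSq (v l))
      = (∑ κ, ∑ l, Complex.normSq (dhat k κ * v l - dhat k l * v κ)) + 2 * Complex.normSq (∑ κ, dflat k κ * v κ) := by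
    exact_mod_cast hC
  rw [lapSym_re hk]
  linear_combination (1 / 2 : ℝ) * hR

/-- [folklore] **THE CURL–CURL BLOCK FORM IS THE CURL ENERGY** (real momentum): with the A–A block `2(L·v_μ − ∂̂_μ Σ_κ ∂̂♭_κ v_κ)` of
`FibreSymbols.curvAdj_curv_plane`, `Σ_μ conj(v_μ)·2(L v_μ − ∂̂_μ(∂̂♭·v)) = ↑Σ_{κ,l} ‖∂̂_κ v_l − ∂̂_l v_κ‖²`. -/
theorem curlBlock_form_eq {k : Fin D → ℂ} (hk : ∀ κ, conj (k κ) = k κ) (v : Fin D → ℂ) :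
    ∑ μ, conj (v μ) * (2 * (lapSym k * v μ - dhat k μ * ∑ κ, dflat k κ * v κ))
      = ((∑ κ, ∑ l, Complex.normSq (dhat k κ * v l - dhat k l * v κ) : ℝ) : ℂ) := by
  have hG := gaffney_normSq hk v
  -- rewrite the left-hand side as `2(L Σ conj v·v − conj δ · δ)`
  have e0 : ∑ μ, conj (v μ) * (2 * (lapSym k * v μ - dhat k μ * ∑ κ, dflat k κ * v κ))
      = 2 * (lapSym k * ∑ μ, conj (v μ) * v μ) - 2 * ((∑ μ, dhat k μ * conj (v μ)) * ∑ κ, dflat k κ * v κ) := by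
    rw [Finset.mul_sum, Finset.sum_mul, Finset.mul_sum, Finset.mul_sum, ← Finset.sum_sub_distrib]
    exact Finset.sum_congr rfl fun μ _ => by ring
  have e2 : ∑ μ, conj (v μ) * v μ = ((∑ μ, Complex.normSq (v μ) : ℝ) : ℂ) := by
    rw [Complex.ofReal_sum]; exact Finset.sum_congr rfl fun μ _ => by rw [Complex.normSq_eq_conj_mul_self]
  have e5 : ∑ μ, dhat k μ * conj (v μ) = conj (∑ κ, dflat k κ * v κ) := by
    rw [map_sum]; exact Finset.sum_congr rfl fun μ _ => by rw [map_mul, conj_dflat hk]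
  rw [e0, e2, e5, lapSym_eq_sum_normSq hk, ← Complex.normSq_eq_conj_mul_self, ← lapSym_re hk]
  have hG' : ((lapSym k).re * ∑ κ, Complex.normSq (v κ) : ℝ) - Complex.normSq (∑ κ, dflat k κ * v κ)
      = (1 / 2) * ∑ κ, ∑ l, Complex.normSq (dhat k κ * v l - dhat k l * v κ) := by
    rw [hG]; ring
  have : (2 : ℂ) * (((lapSym k).re : ℂ) * ((∑ μ, Complex.normSq (v μ) : ℝ) : ℂ)) - 2 * ((Complex.normSq (∑ κ, dflat k κ * v κ) : ℝ) : ℂ)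
      = (((2 : ℝ) * (((lapSym k).re * ∑ κ, Complex.normSq (v κ)) - Complex.normSq (∑ κ, dflat k κ * v κ)) : ℝ) : ℂ) := by
    push_cast; ring
  rw [this, hG']
  push_cast; ring

/-- [folklore] … in particular the A–A block form is REAL and NONNEGATIVE at every real momentum (the block `2(L·1 − ∂̂∂̂♭ᵀ)` is positive semidefinite). -/
theorem curlBlock_form_nonneg {k : Fin D → ℂ} (hk : ∀ κ, conj (k κ) = k κ) (v : Fin D → ℂ) :
    0 ≤ (∑ μ, conj (v μ) * (2 * (lapSym k * v μ - dhat k μ * ∑ κ, dflat k κ * v κ))).re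
      ∧ (∑ μ, conj (v μ) * (2 * (lapSym k * v μ - dhat k μ * ∑ κ, dflat k κ * v κ))).im = 0 := by
  rw [curlBlock_form_eq hk v, Complex.ofReal_re, Complex.ofReal_im]
  exact ⟨Finset.sum_nonneg fun κ _ => Finset.sum_nonneg fun l _ => Complex.normSq_nonneg _, rfl⟩

/-- [folklore] **GAFFNEY IN FORM SENSE** (real momentum): curl–curl block form plus twice the divergence energy is `2·L(k)` times the squared norm:
`Σ_μ conj(v_μ)·2(L v_μ − ∂̂_μ(∂̂♭·v)) + 2‖∂̂♭·v‖² = 2·Re L(k)·Σ_κ‖v_κ‖²`. -/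
theorem gaffney_form {k : Fin D → ℂ} (hk : ∀ κ, conj (k κ) = k κ) (v : Fin D → ℂ) :
    ∑ μ, conj (v μ) * (2 * (lapSym k * v μ - dhat k μ * ∑ κ, dflat k κ * v κ))
        + 2 * ((Complex.normSq (∑ κ, dflat k κ * v κ) : ℝ) : ℂ)
      = 2 * (((lapSym k).re * ∑ κ, Complex.normSq (v κ) : ℝ) : ℂ) := by
  rw [curlBlock_form_eq hk v, gaffney_normSq hk v]
  push_cast; ring

/-- [folklore] **FIBRE POINCARÉ–GAFFNEY INEQUALITY** (real momentum): any positive lower bound `λ ≤ Re L(k)` of the Laplacian symbol controls the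
polarisation by its curl and divergence energies, `Σ_κ ‖v_κ‖² ≤ (½ Σ_{κ,l}‖∂̂_κ v_l − ∂̂_l v_κ‖² + ‖∂̂♭·v‖²)/λ`.  (The bound `λ` itself — e.g. of
`(4/π²)|k|²` type — is row P1-L07's, not proved here.) -/
theorem normSq_le_of_le_lapSym {k : Fin D → ℂ} (hk : ∀ κ, conj (k κ) = k κ) (v : Fin D → ℂ) {lam : ℝ} (hlam : 0 < lam)
    (hle : lam ≤ (lapSym k).re) :
    ∑ κ, Complex.normSq (v κ)
      ≤ ((1 / 2) * (∑ κ, ∑ l, Complex.normSq (dhat k κ * v l - dhat k l * v κ)) + Complex.normSq (∑ κ, dflat k κ * v κ)) / lam := by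
  rw [le_div_iff₀ hlam, ← gaffney_normSq hk v, mul_comm]
  exact mul_le_mul_of_nonneg_right hle (Finset.sum_nonneg fun κ _ => Complex.normSq_nonneg _)

/-- [folklore] The same inequality with the curl–curl BLOCK FORM (as delivered by `curvAdj_curv_plane`) in place of the curl energy:
`λ·Σ‖v‖² ≤ ½·Re(Σ_μ conj(v_μ)·2(L v_μ − ∂̂_μ(∂̂♭·v))) + ‖∂̂♭·v‖²`. -/
theorem mul_normSq_le_curlBlock_form {k : Fin D → ℂ} (hk : ∀ κ, conj (k κ) = k κ) (v : Fin D → ℂ) {lam : ℝ}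
    (hle : lam ≤ (lapSym k).re) :
    lam * ∑ κ, Complex.normSq (v κ)
      ≤ (1 / 2) * (∑ μ, conj (v μ) * (2 * (lapSym k * v μ - dhat k μ * ∑ κ, dflat k κ * v κ))).re
          + Complex.normSq (∑ κ, dflat k κ * v κ) := by
  rw [curlBlock_form_eq hk v, Complex.ofReal_re, ← gaffney_normSq hk v]
  exact mul_le_mul_of_nonneg_right hle (Finset.sum_nonneg fun κ _ => Complex.normSq_nonneg _)

end Summit.QuantumFields.BalabanUV.Beta.GAN24.FibreGaffney
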